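import Summits.QuantumFields.YangMills.Theorems.SoloBlindExpObservable
import HarnessLib

/-!
# From the plaquette chessboard estimate to the coupling-field chessboard inequality (any side)

Support file for item stmt-QuantumFields-20194 (`DirichletWindow.AllSidesCouplingChessboard`, K1 of the large-field
sparsity line; seat ym-dw-p1 g3).  Parity-free partition-function algebra.

Let `Z(c) = ∫ exp(-∑_p c_p (N - Re tr ρ U_p)) ∏_e dU_e` be the partition function of the Wilson theory on the torus
`(ℤ/n)^d` with a plaquette-dependent coupling field `c` (product Haar probability measure; `0 < Z(c) ≤ 1` for
`c ≥ 0`).  Suppose the torus satisfies the multi-orientation chessboard estimate for Chebyshev observables,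

  `⟨exp(c ∑_{q ∈ P} φ_q)⟩_{Λ,β} ≤ ⟨exp(c ∑_{all q} φ_q)⟩_{Λ,β} ^ (#P / n^d)`   (`0 ≤ c ≤ β`, all `P`),

as proved for odd `n ≥ 3` in `…AllSidesChessboardOddTorusEstimate` (`wilsonExpectation_expObs_le_rpow_all_odd`).
Then for `0 ≤ κm ≤ β`, a coupling field `κ` with `κm ≤ κ ≤ β` and `κ = β` off a finite set `Z'`:

  `Z(κ) · Z(β)^{#Z'/n^d} ≤ Z(β) · Z(κm)^{#Z'/n^d}`   (`lintegral_couplingField_chessboard_of_expObs`),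

literally in the `∫⁻ … ENNReal.ofReal …` form of the item `AllSidesCouplingChessboard`.  Proof: `Z` is antitone in
the coupling field (plaquette costs are `≥ 0`), so `Z(κ) ≤ Z(κ̃)` with `κ̃ = κm` on `Z'` and `β` elsewhere;
`Z(κ̃) = Z(β) · ⟨exp((β - κm) ∑_{q ∈ Z'} φ_q)⟩_β`; the chessboard estimate with `c = β - κm`; and
`⟨exp(c ∑_{all q} φ_q)⟩_β = Z(β - c)/Z(β) = Z(κm)/Z(β)`.

HONEST FRAMING: finite-torus algebra over tree theorems; nothing here is a statement about the Yang–Mills mass gap.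
-/

noncomputable section

open MeasureTheory Finset
open Literature.MathematicalPhysics.QuantumFieldTheory

namespace Summit.QuantumFields.YangMills.Theorems.AllSidesChessboard

variable {d n N : ℕ} [NeZero n] {G : Type*} [Group G] [TopologicalSpace G]
  [IsTopologicalGroup G] [CompactSpace G] [MeasurableSpace G] [BorelSpace G]
  (ρ : G →* Matrix (Fin N) (Fin N) ℂ)

/-! ### §1. The coupling-field Boltzmann factor -/

omit [TopologicalSpace G] [IsTopologicalGroup G] [CompactSpace G] [MeasurableSpace G] [BorelSpace G] in
/-- The coupling-field Boltzmann factor `exp(-∑_p c_p φ_p(U))`, `φ_p = N - Re tr ρ U_p`. -/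
theorem exp_couplingField_eq (c : Plaquette d n → ℝ) (U : GaugeConfig d n G) :
    Real.exp (-∑ p, c p * ((N : ℝ) - (ρ (plaquetteHolonomy U p.1 p.2.1.1 p.2.1.2)).trace.re)) =
      Real.exp (-∑ p, c p * SoloBlind.plaquetteCost ρ p.1 p.2.1.1 p.2.1.2 U) := rfl

omit [CompactSpace G] in
/-- Measurability of the coupling-field Boltzmann factor. -/
theorem measurable_exp_couplingField (hρ : Continuous ρ) (c : Plaquette d n → ℝ) :
    Measurable fun U : GaugeConfig d n G =>
      Real.exp (-∑ p, c p * SoloBlind.plaquetteCost ρ p.1 p.2.1.1 p.2.1.2 U) :=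
  (Finset.measurable_sum _ fun p _ => (SoloBlind.measurable_plaquetteCost ρ hρ p).const_mul _).neg.exp

omit [MeasurableSpace G] [BorelSpace G] in
/-- For a non-negative coupling field the Boltzmann factor lies in `(0, 1]`. -/
theorem exp_couplingField_le_one (hρ : Continuous ρ) {c : Plaquette d n → ℝ} (hc : ∀ p, 0 ≤ c p)
    (U : GaugeConfig d n G) :
    Real.exp (-∑ p, c p * SoloBlind.plaquetteCost ρ p.1 p.2.1.1 p.2.1.2 U) ≤ 1 := by
  have hρN : ∀ g : G, (ρ g).trace.re ≤ N := fun g => by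
    have h := Literature.RepresentationTheory.CompactGroups.CompactGroup.abs_re_trace_le_card ρ hρ g
    simp only [Fintype.card_fin] at h
    exact (le_abs_self _).trans h
  rw [Real.exp_le_one_iff, neg_nonpos]
  exact sum_nonneg fun p _ => mul_nonneg (hc p) (SoloBlind.plaquetteCost_nonneg ρ hρN _ _ _ U)

/-- Integrability of the coupling-field Boltzmann factor for a non-negative coupling field. -/
theorem integrable_exp_couplingField (hρ : Continuous ρ) {c : Plaquette d n → ℝ} (hc : ∀ p, 0 ≤ c p) :
    Integrable (fun U : GaugeConfig d n G =>
      Real.exp (-∑ p, c p * SoloBlind.plaquetteCost ρ p.1 p.2.1.1 p.2.1.2 U))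
      (Measure.pi fun _ : Edge d n => haarProbability G) :=
  Integrable.of_bound (measurable_exp_couplingField ρ hρ c).aestronglyMeasurable 1
    (ae_of_all _ fun U => by
      rw [Real.norm_eq_abs, Real.abs_exp]; exact exp_couplingField_le_one ρ hρ hc U)

/-- The `∫⁻`-partition function of a non-negative coupling field as a real integral. -/
theorem toReal_lintegral_couplingField (hρ : Continuous ρ) (c : Plaquette d n → ℝ) :
    (∫⁻ U, ENNReal.ofReal
        (Real.exp (-∑ p, c p * ((N : ℝ) - (ρ (plaquetteHolonomy U p.1 p.2.1.1 p.2.1.2)).trace.re)))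
        ∂(Measure.pi fun _ : Edge d n => haarProbability G)).toReal =
      ∫ U, Real.exp (-∑ p, c p * SoloBlind.plaquetteCost ρ p.1 p.2.1.1 p.2.1.2 U)
        ∂(Measure.pi fun _ : Edge d n => haarProbability G) := by
  rw [integral_eq_lintegral_of_nonneg_ae (ae_of_all _ fun U => (Real.exp_pos _).le)
    (measurable_exp_couplingField ρ hρ c).aestronglyMeasurable]
  rfl

/-- **Antitonicity of the partition function in the coupling field** (plaquette costs are `≥ 0`). -/
theorem integral_exp_couplingField_antitone (hρ : Continuous ρ) {c c' : Plaquette d n → ℝ}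
    (hc : ∀ p, 0 ≤ c p) (hcc' : ∀ p, c p ≤ c' p) :
    ∫ U, Real.exp (-∑ p, c' p * SoloBlind.plaquetteCost ρ p.1 p.2.1.1 p.2.1.2 U)
        ∂(Measure.pi fun _ : Edge d n => haarProbability G) ≤
      ∫ U, Real.exp (-∑ p, c p * SoloBlind.plaquetteCost ρ p.1 p.2.1.1 p.2.1.2 U)
        ∂(Measure.pi fun _ : Edge d n => haarProbability G) := by
  have hρN : ∀ g : G, (ρ g).trace.re ≤ N := fun g => by
    have h := Literature.RepresentationTheory.CompactGroups.CompactGroup.abs_re_trace_le_card ρ hρ g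
    simp only [Fintype.card_fin] at h
    exact (le_abs_self _).trans h
  have hc' : ∀ p, 0 ≤ c' p := fun p => (hc p).trans (hcc' p)
  refine integral_mono (integrable_exp_couplingField ρ hρ hc') (integrable_exp_couplingField ρ hρ hc) fun U => ?_
  refine Real.exp_le_exp.2 (neg_le_neg (sum_le_sum fun p _ => ?_))
  exact mul_le_mul_of_nonneg_right (hcc' p) (SoloBlind.plaquetteCost_nonneg ρ hρN _ _ _ U)

omit [TopologicalSpace G] [IsTopologicalGroup G] [CompactSpace G] [MeasurableSpace G] [BorelSpace G] in
/-- The constant coupling field `β`: `exp(-∑_p β φ_p) = exp(-β S)`. -/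
theorem exp_couplingField_const (β : ℝ) (U : GaugeConfig d n G) :
    Real.exp (-∑ p : Plaquette d n, β * SoloBlind.plaquetteCost ρ p.1 p.2.1.1 p.2.1.2 U) =
      Real.exp (-β * wilsonAction ρ U) := by
  rw [SoloBlind.wilsonAction_eq_sum_plaquetteCost, ← mul_sum, neg_mul]

omit [TopologicalSpace G] [IsTopologicalGroup G] [CompactSpace G] [MeasurableSpace G] [BorelSpace G] in
/-- **The two-valued coupling field is a Chebyshev weight**: for `κ̃ = κm` on `Z'` and `β` elsewhere,
`exp(-∑_p κ̃_p φ_p) = exp((β - κm) ∑_{q ∈ Z'} φ_q) · exp(-β S)`. -/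
theorem exp_couplingField_two_valued (β κm : ℝ) (Z' : Finset (Plaquette d n)) (U : GaugeConfig d n G) :
    Real.exp (-∑ p, (if p ∈ Z' then κm else β) * SoloBlind.plaquetteCost ρ p.1 p.2.1.1 p.2.1.2 U) =
      SoloBlind.expObs ρ (β - κm) Z' U * Real.exp (-β * wilsonAction ρ U) := by
  classical
  rw [SoloBlind.expObs, ← Real.exp_add, SoloBlind.wilsonAction_eq_sum_plaquetteCost]
  congr 1
  have hpt : ∀ p : Plaquette d n, (if p ∈ Z' then κm else β) * SoloBlind.plaquetteCost ρ p.1 p.2.1.1 p.2.1.2 U =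
      β * SoloBlind.plaquetteCost ρ p.1 p.2.1.1 p.2.1.2 U -
        (if p ∈ Z' then (β - κm) * SoloBlind.plaquetteCost ρ p.1 p.2.1.1 p.2.1.2 U else 0) := by
    intro p; split_ifs <;> ring
  simp_rw [hpt]
  rw [sum_sub_distrib, sum_ite_mem, univ_inter, ← mul_sum, ← mul_sum]
  ring

/-! ### §2. The coupling-field chessboard inequality from the plaquette chessboard estimate -/

/-- **From the multi-orientation chessboard estimate for Chebyshev observables to the coupling-field chessboard
inequality `Z(κ) · Z(β)^{#Z'/n^d} ≤ Z(β) · Z(κm)^{#Z'/n^d}`** (real-integral form). -/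
theorem integral_couplingField_chessboard_of_expObs (hρ : Continuous ρ)
    (hchess : ∀ (β c : ℝ), 0 ≤ c → c ≤ β → ∀ P : Finset (Plaquette d n),
      wilsonExpectation ρ β (SoloBlind.expObs (G := G) ρ c P) ≤
        wilsonExpectation ρ β (SoloBlind.expObs (G := G) ρ c (univ : Finset (Plaquette d n))) ^
          ((#P : ℝ) / (n : ℝ) ^ d))
    {β κm : ℝ} (hκm : 0 ≤ κm) (hκmβ : κm ≤ β) (κ : Plaquette d n → ℝ) (Z' : Finset (Plaquette d n))
    (hκ : ∀ p, κm ≤ κ p ∧ κ p ≤ β) (hoff : ∀ p ∉ Z', κ p = β) :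
    (∫ U, Real.exp (-∑ p, κ p * SoloBlind.plaquetteCost ρ p.1 p.2.1.1 p.2.1.2 U)
        ∂(Measure.pi fun _ : Edge d n => haarProbability G)) *
      (∫ U, Real.exp (-∑ p : Plaquette d n, β * SoloBlind.plaquetteCost ρ p.1 p.2.1.1 p.2.1.2 U)
        ∂(Measure.pi fun _ : Edge d n => haarProbability G)) ^ ((#Z' : ℝ) / (n : ℝ) ^ d) ≤
    (∫ U, Real.exp (-∑ p : Plaquette d n, β * SoloBlind.plaquetteCost ρ p.1 p.2.1.1 p.2.1.2 U)
        ∂(Measure.pi fun _ : Edge d n => haarProbability G)) *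
      (∫ U, Real.exp (-∑ p : Plaquette d n, κm * SoloBlind.plaquetteCost ρ p.1 p.2.1.1 p.2.1.2 U)
        ∂(Measure.pi fun _ : Edge d n => haarProbability G)) ^ ((#Z' : ℝ) / (n : ℝ) ^ d) := by
  classical
  set π₀ : Measure (GaugeConfig d n G) := Measure.pi fun _ : Edge d n => haarProbability G with hπ₀
  set e : ℝ := (#Z' : ℝ) / (n : ℝ) ^ d with he
  have he0 : 0 ≤ e := by positivity
  -- the partition functions at constant coupling as `∫ e^{-bS}`
  have hconst : ∀ b : ℝ, (∫ U, Real.exp (-∑ p : Plaquette d n, b * SoloBlind.plaquetteCost ρ p.1 p.2.1.1 p.2.1.2 U) ∂π₀) =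
      ∫ U, Real.exp (-b * wilsonAction ρ U) ∂π₀ := fun b =>
    integral_congr_ae (ae_of_all _ fun U => exp_couplingField_const ρ b U)
  have hZpos : ∀ b : ℝ, 0 < ∫ U, Real.exp (-b * wilsonAction ρ U) ∂π₀ := fun b =>
    integral_exp_neg_mul_wilsonAction_pos ρ hρ b
  rw [hconst β, hconst κm]
  set Zβ := ∫ U, Real.exp (-β * wilsonAction ρ U) ∂π₀ with hZβ
  set Zm := ∫ U, Real.exp (-κm * wilsonAction ρ U) ∂π₀ with hZm
  -- (a) antitonicity: `Z(κ) ≤ Z(κ̃)`, `κ̃ = κm` on `Z'`, `β` elsewhere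
  set κt : Plaquette d n → ℝ := fun p => if p ∈ Z' then κm else β with hκt
  have hκt0 : ∀ p, 0 ≤ κt p := fun p => by
    simp only [hκt]; split_ifs; exacts [hκm, hκm.trans hκmβ]
  have hκtle : ∀ p, κt p ≤ κ p := fun p => by
    simp only [hκt]
    split_ifs with hp
    · exact (hκ p).1
    · exact (hoff p hp).ge
  have ha : (∫ U, Real.exp (-∑ p, κ p * SoloBlind.plaquetteCost ρ p.1 p.2.1.1 p.2.1.2 U) ∂π₀) ≤
      ∫ U, Real.exp (-∑ p, κt p * SoloBlind.plaquetteCost ρ p.1 p.2.1.1 p.2.1.2 U) ∂π₀ :=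
    integral_exp_couplingField_antitone ρ hρ hκt0 hκtle
  -- (b) `Z(κ̃) = Z(β) · ⟨exp((β - κm) ∑_{Z'} φ)⟩_β`
  have hb : (∫ U, Real.exp (-∑ p, κt p * SoloBlind.plaquetteCost ρ p.1 p.2.1.1 p.2.1.2 U) ∂π₀) =
      Zβ * wilsonExpectation ρ β (SoloBlind.expObs (G := G) ρ (β - κm) Z') := by
    rw [wilsonExpectation_eq_integral_div ρ hρ β, ← hπ₀, ← hZβ, mul_div_cancel₀ _ (hZpos β).ne']
    exact integral_congr_ae (ae_of_all _ fun U => exp_couplingField_two_valued ρ β κm Z' U)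
  -- (c) the chessboard estimate with `c = β - κm`
  have hc := hchess β (β - κm) (sub_nonneg.2 hκmβ) (sub_le_self β hκm) Z'
  -- (d) `⟨exp((β - κm) S)⟩_β = Z(κm)/Z(β)`
  have hd : wilsonExpectation ρ β (SoloBlind.expObs (G := G) ρ (β - κm) (univ : Finset (Plaquette d n))) =
      Zm / Zβ := by
    rw [wilsonExpectation_eq_integral_div ρ hρ β, ← hπ₀, ← hZβ]
    congr 1
    refine integral_congr_ae (ae_of_all _ fun U => ?_)
    show SoloBlind.expObs ρ (β - κm) univ U * Real.exp (-β * wilsonAction ρ U) = Real.exp (-κm * wilsonAction ρ U)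
    rw [SoloBlind.expObs, ← SoloBlind.wilsonAction_eq_sum_plaquetteCost, ← Real.exp_add]
    congr 1; ring
  rw [hd, ← he] at hc
  -- (e) combine
  have hW0 : 0 ≤ wilsonExpectation ρ β (SoloBlind.expObs (G := G) ρ (β - κm) Z') :=
    SoloBlind.wilsonExpectation_expObs_nonneg ρ β _ _
  have hZβ0 : 0 < Zβ := hZpos β
  have hZm0 : 0 < Zm := hZpos κm
  have key : (∫ U, Real.exp (-∑ p, κ p * SoloBlind.plaquetteCost ρ p.1 p.2.1.1 p.2.1.2 U) ∂π₀) ≤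
      Zβ * (Zm / Zβ) ^ e :=
    ha.trans (hb.le.trans (mul_le_mul_of_nonneg_left hc hZβ0.le))
  rw [Real.div_rpow hZm0.le hZβ0.le] at key
  have hZβe : 0 < Zβ ^ e := Real.rpow_pos_of_pos hZβ0 e
  calc (∫ U, Real.exp (-∑ p, κ p * SoloBlind.plaquetteCost ρ p.1 p.2.1.1 p.2.1.2 U) ∂π₀) * Zβ ^ e
      ≤ Zβ * (Zm ^ e / Zβ ^ e) * Zβ ^ e := mul_le_mul_of_nonneg_right key hZβe.le
    _ = Zβ * Zm ^ e := by field_simp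

/-- **The coupling-field chessboard inequality in the `∫⁻` form of the item `AllSidesCouplingChessboard`**, from the
multi-orientation chessboard estimate for Chebyshev observables on the same torus. -/
theorem lintegral_couplingField_chessboard_of_expObs (hρ : Continuous ρ)
    (hchess : ∀ (β c : ℝ), 0 ≤ c → c ≤ β → ∀ P : Finset (Plaquette d n),
      wilsonExpectation ρ β (SoloBlind.expObs (G := G) ρ c P) ≤
        wilsonExpectation ρ β (SoloBlind.expObs (G := G) ρ c (univ : Finset (Plaquette d n))) ^
          ((#P : ℝ) / (n : ℝ) ^ d))
    {β κm : ℝ} (hκm : 0 ≤ κm) (hκmβ : κm ≤ β) (κ : Plaquette d n → ℝ) (Z' : Finset (Plaquette d n))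
    (hκ : ∀ p, κm ≤ κ p ∧ κ p ≤ β) (hoff : ∀ p ∉ Z', κ p = β) :
    (∫⁻ U, ENNReal.ofReal
        (Real.exp (-∑ p, κ p * ((N : ℝ) - (ρ (plaquetteHolonomy U p.1 p.2.1.1 p.2.1.2)).trace.re)))
        ∂(Measure.pi fun _ : Edge d n => haarProbability G)).toReal *
      (∫⁻ U, ENNReal.ofReal
        (Real.exp (-∑ p : Plaquette d n, β * ((N : ℝ) - (ρ (plaquetteHolonomy U p.1 p.2.1.1 p.2.1.2)).trace.re)))
        ∂(Measure.pi fun _ : Edge d n => haarProbability G)).toReal ^ ((#Z' : ℝ) / (n : ℝ) ^ d) ≤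
    (∫⁻ U, ENNReal.ofReal
        (Real.exp (-∑ p : Plaquette d n, β * ((N : ℝ) - (ρ (plaquetteHolonomy U p.1 p.2.1.1 p.2.1.2)).trace.re)))
        ∂(Measure.pi fun _ : Edge d n => haarProbability G)).toReal *
      (∫⁻ U, ENNReal.ofReal
        (Real.exp (-∑ p : Plaquette d n, κm * ((N : ℝ) - (ρ (plaquetteHolonomy U p.1 p.2.1.1 p.2.1.2)).trace.re)))
        ∂(Measure.pi fun _ : Edge d n => haarProbability G)).toReal ^ ((#Z' : ℝ) / (n : ℝ) ^ d) := by
  rw [toReal_lintegral_couplingField ρ hρ κ, toReal_lintegral_couplingField ρ hρ (fun _ => β),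
    toReal_lintegral_couplingField ρ hρ (fun _ => κm)]
  exact integral_couplingField_chessboard_of_expObs ρ hρ hchess hκm hκmβ κ Z' hκ hoff

end Summit.QuantumFields.YangMills.Theorems.AllSidesChessboard

end
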